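import Mathlib

/-!
# Rank-one spectral projectors: norm = condition number, and the resolvent sum bound

Solo-blind kernel #95 (paper §24.46(4)–(5), §24.47, Theorem-candidate 24.B (Q)(β)).
For a simple eigenvalue with right vector `r` and left vector `l` (pairing `⟪l, r⟫ ≠ 0`) the spectral
projector is the rank-one map `x ↦ ⟪l, x⟫ / ⟪l, r⟫ • r`; its operator norm is EXACTLY the pencil
condition number `‖l‖ ‖r‖ / |⟪l, r⟫|` (the quantity κ_p measured per rung and reproduced by the
transport lemma), and a finite sum of such projectors weighted by `(λ_i - z)⁻¹` — the resolvent of a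
diagonalisable finite-rank part — is bounded by `∑ κ_i / |λ_i - z|`.  This is the finite-dimensional
link "κ_p per rung ⇒ resolvent bound between rungs" used in the reduction of (Q)(β).
-/

namespace Summit.AnomalousDissipation.AnomalousDissipation.Theorems

open scoped RealInnerProductSpace

variable {E : Type*} [NormedAddCommGroup E] [InnerProductSpace ℝ E]

/-- The rank-one map `x ↦ (⟪l, x⟫ / ⟪l, r⟫) • r` (spectral projector of a simple eigenvalue with
left vector `l` and right vector `r`). -/
noncomputable def rankOneProj (l r : E) : E →L[ℝ] E :=
  (⟪l, r⟫)⁻¹ • (innerSL ℝ l).smulRight r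

/-- Pointwise formula. -/
theorem rankOneProj_apply (l r x : E) :
    rankOneProj l r x = (⟪l, r⟫)⁻¹ • (⟪l, x⟫ • r) := by
  simp [rankOneProj, ContinuousLinearMap.smulRight_apply]

/-- It fixes `r` when the pairing is non-degenerate. -/
theorem rankOneProj_apply_self (l r : E) (h : ⟪l, r⟫ ≠ 0) : rankOneProj l r r = r := by
  rw [rankOneProj_apply, smul_smul, inv_mul_cancel₀ h, one_smul]

/-- It is idempotent when the pairing is non-degenerate. -/
theorem rankOneProj_idem (l r : E) (h : ⟪l, r⟫ ≠ 0) (x : E) :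
    rankOneProj l r (rankOneProj l r x) = rankOneProj l r x := by
  rw [rankOneProj_apply l r x, map_smul, map_smul, rankOneProj_apply_self l r h]

/-- NORM = CONDITION NUMBER: `‖P‖ = ‖l‖ ‖r‖ / |⟪l, r⟫|`. -/
theorem norm_rankOneProj (l r : E) : ‖rankOneProj l r‖ = |⟪l, r⟫|⁻¹ * (‖l‖ * ‖r‖) := by
  rw [rankOneProj, norm_smul, ContinuousLinearMap.norm_smulRight_apply, innerSL_apply_norm,
    norm_inv, Real.norm_eq_abs]

/-- With unit vectors the norm is `1 / |⟪l, r⟫|` (the `1/|l·r|` of the section condition number). -/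
theorem norm_rankOneProj_unit (l r : E) (hl : ‖l‖ = 1) (hr : ‖r‖ = 1) :
    ‖rankOneProj l r‖ = |⟪l, r⟫|⁻¹ := by
  rw [norm_rankOneProj, hl, hr, mul_one, mul_one]

/-- The condition number is at least one (Cauchy–Schwarz), for a non-degenerate pairing. -/
theorem one_le_norm_rankOneProj (l r : E) (h : ⟪l, r⟫ ≠ 0) : 1 ≤ ‖rankOneProj l r‖ := by
  rw [norm_rankOneProj]
  have hcs : |⟪l, r⟫| ≤ ‖l‖ * ‖r‖ := abs_real_inner_le_norm l r
  have hpos : 0 < |⟪l, r⟫| := abs_pos.mpr h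
  rw [le_inv_mul_iff₀ hpos, mul_one]
  exact hcs

/-- RESOLVENT SUM BOUND: `‖∑ (λ_i - z)⁻¹ • P_i‖ ≤ ∑ |λ_i - z|⁻¹ · ‖l_i‖ ‖r_i‖ / |⟪l_i, r_i⟫|`. -/
theorem norm_resolventSum_le {ι : Type*} (s : Finset ι) (lam : ι → ℝ) (z : ℝ) (l r : ι → E) :
    ‖∑ i ∈ s, (lam i - z)⁻¹ • rankOneProj (l i) (r i)‖
      ≤ ∑ i ∈ s, |lam i - z|⁻¹ * (|⟪l i, r i⟫|⁻¹ * (‖l i‖ * ‖r i‖)) := by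
  refine (norm_sum_le _ _).trans (Finset.sum_le_sum fun i _ => ?_)
  rw [norm_smul, norm_inv, Real.norm_eq_abs, norm_rankOneProj]

/-- Uniform version: if every condition number is at most `κ`, the resolvent sum is bounded by
`κ · ∑ |λ_i - z|⁻¹`. -/
theorem norm_resolventSum_le_of_cond_le {ι : Type*} (s : Finset ι) (lam : ι → ℝ) (z : ℝ)
    (l r : ι → E) (κ : ℝ) (hκ : ∀ i ∈ s, |⟪l i, r i⟫|⁻¹ * (‖l i‖ * ‖r i‖) ≤ κ) :
    ‖∑ i ∈ s, (lam i - z)⁻¹ • rankOneProj (l i) (r i)‖ ≤ κ * ∑ i ∈ s, |lam i - z|⁻¹ := by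
  refine (norm_resolventSum_le s lam z l r).trans ?_
  rw [Finset.mul_sum]
  refine Finset.sum_le_sum fun i hi => ?_
  rw [mul_comm κ]
  exact mul_le_mul_of_nonneg_left (hκ i hi) (inv_nonneg.mpr (abs_nonneg _))

end Summit.AnomalousDissipation.AnomalousDissipation.Theorems
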